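import Mathlib
import Literature.Geometry.GeometricMeasureTheory.CubicalSubdivision

/-!
# `Summit.QuantumFields.BalabanUV.Beta.UnitLatticePartitionProfile` — INSTANCE DATA for route A.3′'s partition binders, 1-D
# core: the cosine profile `f_M(t) = cos(π/2 · clamp(t/M))` (`= cos(πt/(2M))` for `|t| ≤ M`, `= 0` for `|t| ≥ M`) is bounded by
# `1`, `(π/(2M))`-Lipschitz, and its translates by the centres `0, M, 2M, …, qM` satisfy `Σ_b f_M(y − bM)² = 1` EXACTLY on
# `[0, qM]` (at each point only two consecutive centres contribute, with `cos² + sin² = 1`)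

HONEST FRAMING (page 1 of everything in this cell).  Discharging `FlowStep.BetaPertH` would make Bałaban's ultraviolet
stability UNCONDITIONAL — a constructive-QFT result; NOT the continuum limit, NOT the Clay problem.  This module
discharges nothing of `BetaPertH`; [folklore] one-variable calculus, kernel-checked (unit `b2b-balaban-beta-d4-p3`, road P3,
gen 4).  WHY: the abstract spine of route A.3′ (`UnitLatticeWalkInversion` … `UnitLatticeOmegaRowData`, and the owner's
`AnalyticWalkSum216RowResolvent`) takes PARTITION DATA as hypotheses — `Σ_b h_b² = 1` pointwise, `supp h_b ⊆ □̃_b`,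
`|h_b| ≤ 1`, `|h_b(y) − h_b(y′)| ≤ d(y,y′)/M`, overlap `≤ N`.  This file and its sibling `UnitLatticePartition` CONSTRUCT such
data on boxes of `ℤ^ν` with explicit constants (`N = 3^ν`, `M_eff = 2M/(νπ)`), so that this part of the instance dictionary
R_A is kernel, not assumed.  CONTEXT (located, not used): [I] = CMP **109** (1987) p. 270 below (3.1) (the smooth
partition `1 = Σ_□ ζ_□`, product form `ζ_□(x) = Π_μ ζ(M⁻¹(x_μ − y_μ))`); [II] = CMP **116** (1988) (1.37).
HONEST DEPENDENCY: continuum YM on T⁴ ⇐ BetaPertH ∧ nine spine estimates (0/9 proved); BetaPertH ⇐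
(D1) ∧ (D4) ∧ CAP+tail; G-an2-4 gates asym, D1 and NE2/3/4.

CONTENTS (0 sorry).  §1 `bump M t` (with the tree's `Cubical.clamp`, `Literature/Geometry/GeometricMeasureTheory/CubicalSubdivision`, BY NAME) and their elementary properties (`abs_bump_le_one`, `bump_of_le_abs`,
`abs_bump_sub_bump_le` = the Lipschitz bound `π/(2M)`, `bump_sq_add_bump_sq` = `cos² + sin² = 1` for two consecutive
centres).  §2 **`sum_bump_sq_eq_one`**: `Σ_{b < q+1} bump M (y − bM)² = 1` for `0 ≤ y ≤ qM` (induction on `q`).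
NOT HERE: the `ν`-dimensional product, supports, overlap count (sibling); anything about Bałaban's operators.
NOT summit progress.
-/

open scoped BigOperators
open Finset Real

namespace Summit.QuantumFields.BalabanUV.Beta.UnitLatticePartitionProfile

open Literature.Geometry.GeometricMeasureTheory.Cubical (clamp clamp_of_abs_le clamp_of_one_le clamp_of_le_neg_one)

noncomputable section

/-! ## §1 The profile -/

/-- THE PROFILE `f_M(t) = cos(π/2 · clamp(t/M))`: `cos(πt/(2M))` on `|t| ≤ M`, `0` outside. [folklore] -/
def bump (M : ℝ) (t : ℝ) : ℝ := Real.cos (π / 2 * clamp (t / M))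

/-- `|f_M| ≤ 1`. [folklore] -/
theorem abs_bump_le_one (M t : ℝ) : |bump M t| ≤ 1 := abs_cos_le_one _

/-- `f_M(t) = cos(πt/(2M))` for `|t| ≤ M`. [folklore] -/
theorem bump_of_abs_le {M : ℝ} (hM : 0 < M) {t : ℝ} (ht : |t| ≤ M) : bump M t = Real.cos (π / 2 * (t / M)) := by
  rw [bump, clamp_of_abs_le]
  rw [abs_div, abs_of_pos hM]
  exact (div_le_one hM).2 ht

/-- `f_M(t) = 0` for `|t| ≥ M`. [folklore] -/
theorem bump_of_le_abs {M : ℝ} (hM : 0 < M) {t : ℝ} (ht : M ≤ |t|) : bump M t = 0 := by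
  rw [bump]
  rcases le_or_gt 0 t with h0 | h0
  · rw [abs_of_nonneg h0] at ht
    rw [clamp_of_one_le ((one_le_div hM).2 ht), mul_one, cos_pi_div_two]
  · rw [abs_of_neg h0] at ht
    have : t / M ≤ -1 := by rw [div_le_iff₀ hM]; linarith
    rw [clamp_of_le_neg_one this, mul_neg, mul_one, Real.cos_neg, cos_pi_div_two]

/-- **THE LIPSCHITZ BOUND**: `|f_M(t) − f_M(t′)| ≤ (π/(2M))·|t − t′|`. [folklore] -/
theorem abs_bump_sub_bump_le {M : ℝ} (hM : 0 < M) (t t' : ℝ) : |bump M t - bump M t'| ≤ π / (2 * M) * |t - t'| := by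
  -- the tree's `clamp s = max (−1) (min 1 s)` is `1`-Lipschitz
  have hcl : ∀ s s' : ℝ, |clamp s - clamp s'| ≤ |s - s'| := fun s s' =>
    calc |clamp s - clamp s'| = |max (-1) (min 1 s) - max (-1) (min 1 s')| := rfl
      _ ≤ max |(-1 : ℝ) - (-1)| |min 1 s - min 1 s'| := abs_max_sub_max_le_max _ _ _ _
      _ ≤ max |(-1 : ℝ) - (-1)| (max |(1 : ℝ) - 1| |s - s'|) := max_le_max le_rfl (abs_min_sub_min_le_max _ _ _ _)
      _ = |s - s'| := by simp [abs_nonneg]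
  unfold bump
  calc |Real.cos (π / 2 * clamp (t / M)) - Real.cos (π / 2 * clamp (t' / M))|
      ≤ |π / 2 * clamp (t / M) - π / 2 * clamp (t' / M)| := abs_cos_sub_cos_le _ _
    _ = π / 2 * |clamp (t / M) - clamp (t' / M)| := by
        rw [← mul_sub, abs_mul, abs_of_pos (by positivity)]
    _ ≤ π / 2 * |t / M - t' / M| := mul_le_mul_of_nonneg_left (hcl _ _) (by positivity)
    _ = π / (2 * M) * |t - t'| := by
        rw [← sub_div, abs_div, abs_of_pos hM]
        field_simp

/-- **TWO CONSECUTIVE CENTRES**: for `0 ≤ s ≤ M`, `f_M(s)² + f_M(s − M)² = cos²(πs/(2M)) + sin²(πs/(2M)) = 1`. [folklore] -/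
theorem bump_sq_add_bump_sq {M : ℝ} (hM : 0 < M) {s : ℝ} (hs0 : 0 ≤ s) (hs1 : s ≤ M) :
    bump M s ^ 2 + bump M (s - M) ^ 2 = 1 := by
  have h1 : |s| ≤ M := by rw [abs_of_nonneg hs0]; exact hs1
  have h2 : |s - M| ≤ M := by rw [abs_sub_comm, abs_of_nonneg (by linarith)]; linarith
  rw [bump_of_abs_le hM h1, bump_of_abs_le hM h2]
  have : π / 2 * ((s - M) / M) = π / 2 * (s / M) - π / 2 := by rw [sub_div, div_self hM.ne']; ring
  rw [this, Real.cos_sub_pi_div_two, Real.cos_sq_add_sin_sq]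

/-! ## §2 The partition identity on `[0, qM]` -/

/-- A centre at distance `≥ M` does not contribute. [folklore] -/
theorem bump_sub_eq_zero_of_le {M : ℝ} (hM : 0 < M) {y c : ℝ} (h : M ≤ |y - c|) : bump M (y - c) = 0 :=
  bump_of_le_abs hM h

/-- **`Σ_{b=0}^{q} f_M(y − bM)² = 1` for `0 ≤ y ≤ qM`** (at `y ∈ [qM − M, qM]` the two centres `(q−1)M, qM` contribute
`cos² + sin²`, all others vanish; induction on `q`). [folklore] -/
theorem sum_bump_sq_eq_one {M : ℝ} (hM : 0 < M) :
    ∀ (q : ℕ) (y : ℝ), 0 ≤ y → y ≤ q * M → ∑ b ∈ Finset.range (q + 1), bump M (y - b * M) ^ 2 = 1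
  | 0, y, hy0, hy1 => by
      have hy : y = 0 := le_antisymm (by simpa using hy1) hy0
      subst hy
      rw [Finset.sum_range_one, Nat.cast_zero, zero_mul, sub_zero, bump_of_abs_le hM (by simp [hM.le])]
      simp
  | q + 1, y, hy0, hy1 => by
      by_cases hy : y ≤ q * M
      · -- the new centre (q+1)M is at distance ≥ M: it does not contribute
        rw [Finset.sum_range_succ, sum_bump_sq_eq_one hM q y hy0 hy, add_eq_left, sq_eq_zero_iff]
        refine bump_of_le_abs hM ?_
        rw [abs_sub_comm, abs_of_nonneg (by push_cast; nlinarith [hM])]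
        push_cast
        linarith
      · -- y ∈ (qM, (q+1)M]: only the centres qM and (q+1)M contribute
        push Not at hy
        rw [Finset.sum_range_succ, Finset.sum_range_succ]
        have hzero : ∑ b ∈ Finset.range q, bump M (y - b * M) ^ 2 = 0 := by
          refine Finset.sum_eq_zero fun b hb => ?_
          rw [Finset.mem_range] at hb
          rw [sq_eq_zero_iff]
          refine bump_of_le_abs hM ?_
          have hb' : (b : ℝ) + 1 ≤ q := by exact_mod_cast hb
          rw [abs_of_nonneg (by nlinarith [hM])]
          nlinarith [hM]
        rw [hzero, zero_add]
        have hs := bump_sq_add_bump_sq hM (s := y - q * M) (by linarith) (by push_cast at hy1; linarith)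
        have : y - q * M - M = y - ((q + 1 : ℕ) : ℝ) * M := by push_cast; ring
        rwa [this] at hs

end

end Summit.QuantumFields.BalabanUV.Beta.UnitLatticePartitionProfile
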